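import Mathlib
import Literature.NumberTheory.Transcendental.OnePeriods
import HarnessLib

/-!
# Crux NUM `CartanOnePlaceDegreeLawAtThree` (item stmt-BirchSwinnertonDyer-24801), node `cmrank` — generic linear algebra of the
# RATIONALITY DESCENT (DESC): rank by trace over `ℂ`, the trace of a real form, averaging onto a fixed line, lattice CM from two periods

Seat `bsd-stepL-tam3-p1` g33 (LEAD of crux 24801; `--supports stmt-BirchSwinnertonDyer-24801`). Pure linear algebra over Mathlib, no curve,
no modular form; consumed by `…CMRankDescent` (the proof of the cmrank node's stub `stub_latticeCharacterDescent`, i.e. (M)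
`CartanCover.PeriodLatticeCharacter` from the complex K-type (CTYPE)).

* §1 `exists_eq_smul_of_trace_sum_eq_card` — RANK BY TRACE over `ℂ`: for `ρ : G →* End_ℂ(W)` (`W`
  finite-dimensional) and a finite subgroup `T₀` with `Σ_{t ∈ T₀} tr ρ(t) = |T₀|`, the `T₀`-fixed subspace is a line; so every fixed vector is a
  multiple of a given non-zero fixed vector (the field twin of the tree's `CartanSupply.CubicLattice.exists_generator_of_trace_rep`).
* §2 `linearIndependent_complex_of_real` ∕ `trace_eq_sum_diag_of_realForm` — THE TRACE OF A REAL FORM: if `b : Fin n → V` is `ℝ`-free in a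
  `ℂ`-space, `W = ℂ·b`, and the real span `ℝ·b` meets `i·(ℝ·b)` only in `0`, then `b` is a `ℂ`-basis of `W` and a `ℂ`-endomorphism of `W`
  with INTEGER matrix `A` on `b` has trace `Σ A i i`.
* §3 `exists_mem_span_eq_smul_im_ne_zero` — AVERAGING: if moreover `i·u ∈ ℝ·b` for a non-zero `T₀`-fixed `u`, `T₀` preserves `ℤ·b`, and every
  `T₀`-fixed vector of `ℤ·b` is a complex multiple of `u`, then some vector of `ℤ·b` is `c·u` with `c ∉ ℝ` (average `i·u = Σ r_j b_j` over `T₀`).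
* §4 `hasCM_of_mul_mem` — a period lattice `Λ` containing two `ℝ`-independent `p₁, p₂` with `c p₁, c p₂ ∈ Λ`, `c ∉ ℝ`, has complex
  multiplication (`PeriodPair.HasCM`: the multiplier `δ c`, `δ = det(p₁, p₂ | ω₁, ω₂) ≠ 0`).
HONEST: generic lemmas; nothing about any curve, form or item is proved here; BSD is proved for no curve. [folklore]
-/

set_option linter.dupNamespace false
set_option autoImplicit false

noncomputable section

open scoped Classical
open Module

namespace Summit.BirchSwinnertonDyer.BirchSwinnertonDyer.Theorems.CartanCover.CMRank

/-! ## §1 Rank by trace over `ℂ` -/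

section RankByTrace

variable {G : Type*} [Group G] {W : Type*} [AddCommGroup W] [Module ℂ W]

variable [FiniteDimensional ℂ W]

/-- **RANK BY TRACE over `ℂ`: every fixed vector is a multiple of a given non-zero fixed vector** when `Σ_{t ∈ T₀} tr ρ(t) = |T₀|`
(the averaging map `Q = Σ_t ρ(t) : W → W^{T₀}` satisfies `Q ∘ ι = |T₀|·id`; taking traces gives `dim W^{T₀} = 1`; the field twin of the tree's
`CartanSupply.CubicLattice.exists_generator_of_trace_rep`). [folklore] -/
theorem exists_eq_smul_of_trace_sum_eq_card (ρ : G →* Module.End ℂ W) (T₀ : Subgroup G) [Fintype T₀]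
    (hsum : ∑ t : T₀, LinearMap.trace ℂ W (ρ (t : G)) = Nat.card T₀) {u : W} (hu0 : u ≠ 0)
    (hu : ∀ t ∈ T₀, ρ t u = u) (v : W) (hv : ∀ t ∈ T₀, ρ t v = v) : ∃ c : ℂ, v = c • u := by
  -- the fixed subspace `F`
  let F : Submodule ℂ W :=
    { carrier := {v | ∀ t ∈ T₀, ρ t v = v}
      add_mem' := fun {a b} ha hb t ht => by rw [map_add, ha t ht, hb t ht]
      zero_mem' := fun t _ => map_zero _
      smul_mem' := fun c {a} ha t ht => by rw [map_smul, ha t ht] }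
  have hmul : ∀ (t s : G) (v : W), ρ t (ρ s v) = ρ (t * s) v := fun t s v => by
    rw [map_mul, Module.End.mul_apply]
  have hQmem : ∀ x : W, (∑ t : T₀, ρ (t : G) x) ∈ F := by
    intro x t ht
    rw [map_sum]
    simp only [hmul]
    exact Fintype.sum_equiv (Equiv.mulLeft (⟨t, ht⟩ : T₀)) _ _ (fun s => rfl)
  let Q : W →ₗ[ℂ] F :=
    { toFun := fun x => ⟨∑ t : T₀, ρ (t : G) x, hQmem x⟩
      map_add' := by
        intro x y; apply Subtype.ext
        simp only [Submodule.coe_add, map_add, Finset.sum_add_distrib]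
      map_smul' := by
        intro c x; apply Subtype.ext
        simp only [Submodule.coe_smul, map_smul, Finset.smul_sum, RingHom.id_apply] }
  let ι : F →ₗ[ℂ] W := F.subtype
  have h1 : ι ∘ₗ Q = ∑ t : T₀, ρ (t : G) := by
    apply LinearMap.ext; intro x
    rw [LinearMap.sum_apply]; rfl
  have h2 : LinearMap.trace ℂ W (ι ∘ₗ Q) = Nat.card T₀ := by rw [h1, map_sum, hsum]
  have h3 : Q ∘ₗ ι = (Nat.card T₀ : ℂ) • LinearMap.id := by
    apply LinearMap.ext; intro y; apply Subtype.ext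
    have hy : ∀ t : T₀, ρ (t : G) (y : W) = y := fun t => y.2 t t.2
    show (∑ t : T₀, ρ (t : G) (y : W)) = ((((Nat.card T₀ : ℂ)) • y : F) : W)
    simp only [hy, Finset.sum_const, Finset.card_univ, Submodule.coe_smul, Nat.card_eq_fintype_card]
    rw [Nat.cast_smul_eq_nsmul]
  have h4 : (Nat.card T₀ : ℂ) * 1 = (Nat.card T₀ : ℂ) * finrank ℂ F := by
    have h := LinearMap.trace_comp_comm' Q ι
    rw [h2, h3, map_smul, LinearMap.trace_id, smul_eq_mul] at h
    rw [mul_one]; exact h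
  have hT : (Nat.card T₀ : ℂ) ≠ 0 := by exact_mod_cast Nat.card_pos.ne'
  have hrank : finrank ℂ F = 1 := by exact_mod_cast (mul_left_cancel₀ hT h4).symm
  -- `F` is the line through `u`
  have hu' : (⟨u, hu⟩ : F) ≠ 0 := fun h => hu0 (congrArg Subtype.val h)
  obtain ⟨c, hc⟩ := (finrank_eq_one_iff_of_nonzero' _ hu').mp hrank ⟨v, hv⟩
  refine ⟨c, ?_⟩
  have h := congrArg Subtype.val hc
  simp only [Submodule.coe_smul] at h
  exact h.symm

end RankByTrace

/-! ## §2 The trace of a real form -/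

section RealForm

variable {V : Type*} [AddCommGroup V] [Module ℂ V]

/-- The real/imaginary decomposition of a complex combination of vectors: `Σ z_i•b_i = Σ (Re z_i)•b_i + i•Σ (Im z_i)•b_i`. [folklore] -/
theorem sum_smul_eq_re_add_im {n : ℕ} (z : Fin n → ℂ) (b : Fin n → V) :
    (∑ i, z i • b i) = (∑ i, (z i).re • b i) + Complex.I • ∑ i, (z i).im • b i := by
  rw [Finset.smul_sum, ← Finset.sum_add_distrib]
  refine Finset.sum_congr rfl fun i _ => ?_
  rw [← Complex.coe_smul, ← Complex.coe_smul, smul_smul, ← add_smul]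
  congr 1
  rw [mul_comm]
  exact (Complex.re_add_im (z i)).symm

/-- **An `ℝ`-free family whose real span meets `i` times itself trivially is `ℂ`-free.** [folklore] -/
theorem linearIndependent_complex_of_real {n : ℕ} {b : Fin n → V} (hli : LinearIndependent ℝ b)
    (hE : ∀ v : V, v ∈ Submodule.span ℝ (Set.range b) → Complex.I • v ∈ Submodule.span ℝ (Set.range b) → v = 0) :
    LinearIndependent ℂ b := by
  rw [Fintype.linearIndependent_iff]
  intro z hz
  have hxmem : (∑ i, (z i).re • b i) ∈ Submodule.span ℝ (Set.range b) :=
    Submodule.sum_mem _ fun i _ => Submodule.smul_mem _ _ (Submodule.subset_span ⟨i, rfl⟩)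
  have hymem : (∑ i, (z i).im • b i) ∈ Submodule.span ℝ (Set.range b) :=
    Submodule.sum_mem _ fun i _ => Submodule.smul_mem _ _ (Submodule.subset_span ⟨i, rfl⟩)
  rw [sum_smul_eq_re_add_im] at hz
  have hIy : Complex.I • (∑ i, (z i).im • b i) = -(∑ i, (z i).re • b i) := eq_neg_of_add_eq_zero_right hz
  have hy0 : (∑ i, (z i).im • b i) = 0 := hE _ hymem (by rw [hIy]; exact Submodule.neg_mem _ hxmem)
  have hy : ∀ i, (z i).im = 0 := Fintype.linearIndependent_iff.mp hli (fun i => (z i).im) hy0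
  have hx0 : (∑ i, (z i).re • b i) = 0 := by rw [hy0, smul_zero, add_zero] at hz; exact hz
  have hx : ∀ i, (z i).re = 0 := Fintype.linearIndependent_iff.mp hli (fun i => (z i).re) hx0
  intro i
  exact Complex.ext (by rw [hx i]; rfl) (by rw [hy i]; rfl)

/-- **THE TRACE OF A REAL FORM.** `b : Fin n → V` is `ℝ`-free with values in the `ℂ`-subspace `W ⊆ ℂ·b`, and the real span `ℝ·b` meets
`i·(ℝ·b)` only in `0`; then a `ℂ`-endomorphism `f` of `W` with `f(b_j) = Σ_i A_{ij} b_i` for an integer matrix `A` has trace `Σ_i A_{ii}`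
(`b` is a `ℂ`-basis of `W`). [folklore] -/
theorem trace_eq_sum_diag_of_realForm {n : ℕ} (W : Submodule ℂ V) (b : Fin n → V) (hbW : ∀ i, b i ∈ W)
    (hli : LinearIndependent ℝ b) (hWle : W ≤ Submodule.span ℂ (Set.range b))
    (hE : ∀ v : V, v ∈ Submodule.span ℝ (Set.range b) → Complex.I • v ∈ Submodule.span ℝ (Set.range b) → v = 0)
    (f : W →ₗ[ℂ] W) (A : Matrix (Fin n) (Fin n) ℤ)
    (hf : ∀ j, ((f ⟨b j, hbW j⟩ : W) : V) = ∑ i, ((A i j : ℤ) : ℂ) • b i) :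
    LinearMap.trace ℂ W f = ∑ i, ((A i i : ℤ) : ℂ) := by
  let bW : Fin n → W := fun i => ⟨b i, hbW i⟩
  have hliC : LinearIndependent ℂ bW :=
    LinearIndependent.of_comp W.subtype (linearIndependent_complex_of_real hli hE)
  have hsp : ⊤ ≤ Submodule.span ℂ (Set.range bW) := by
    rintro w -
    have hw : (w : V) ∈ Submodule.span ℂ (Set.range b) := hWle w.2
    have hrange : Set.range b = W.subtype '' Set.range bW := by
      rw [← Set.range_comp]; rfl
    rw [hrange] at hw
    exact (Submodule.apply_mem_span_image_iff_mem_span W.injective_subtype).mp hw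
  let bC : Basis (Fin n) ℂ W := Basis.mk hliC hsp
  have hbC : ∀ i, bC i = bW i := fun i => Basis.mk_apply hliC hsp i
  rw [LinearMap.trace_eq_matrix_trace ℂ bC, Matrix.trace]
  refine Finset.sum_congr rfl fun i _ => ?_
  rw [Matrix.diag_apply, LinearMap.toMatrix_apply, hbC]
  have hfi : f (bW i) = ∑ k, ((A k i : ℤ) : ℂ) • bC k := by
    apply Subtype.ext
    rw [hf i, Submodule.coe_sum]
    refine Finset.sum_congr rfl fun k _ => ?_
    rw [Submodule.coe_smul, hbC]
  rw [hfi]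
  exact congr_fun (bC.repr_sum_self fun k => ((A k i : ℤ) : ℂ)) i

end RealForm

/-! ## §3 Averaging onto a fixed line -/

section Averaging

variable {G : Type*} [Group G] {V : Type*} [AddCommGroup V] [Module ℂ V]

/-- **AVERAGING.** `T₀` preserves the `ℤ`-span of `b`, fixes `u ≠ 0`, every `T₀`-fixed vector of `ℤ·b` is a complex multiple of `u`, and
`i·u ∈ ℝ·b`: then some vector of `ℤ·b` is `c·u` with `Im c ≠ 0` (apply `Σ_{t ∈ T₀} ρ(t)` to `i·u = Σ r_j b_j`: the left side is `|T₀|·i·u`,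
the right side `Σ r_j c_j · u` with `Σ_t ρ(t) b_j = c_j u`; so `|T₀| i = Σ r_j c_j` and some `c_j ∉ ℝ`). [folklore] -/
theorem exists_mem_span_eq_smul_im_ne_zero {n : ℕ} (ρ : Representation ℂ G V) (T₀ : Subgroup G) [Fintype T₀]
    (b : Fin n → V) (hstab : ∀ t ∈ T₀, ∀ j, ρ t (b j) ∈ Submodule.span ℤ (Set.range b))
    {u : V} (hu0 : u ≠ 0) (hu : ∀ t ∈ T₀, ρ t u = u)
    (hIu : Complex.I • u ∈ Submodule.span ℝ (Set.range b))
    (hline : ∀ v ∈ Submodule.span ℤ (Set.range b), (∀ t ∈ T₀, ρ t v = v) → ∃ c : ℂ, v = c • u) :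
    ∃ v ∈ Submodule.span ℤ (Set.range b), ∃ c : ℂ, v = c • u ∧ c.im ≠ 0 := by
  obtain ⟨r, hr⟩ := (Submodule.mem_span_range_iff_exists_fun ℝ).mp hIu
  have hmul : ∀ (t s : G) (v : V), ρ t (ρ s v) = ρ (t * s) v := fun t s v => by
    rw [map_mul, Module.End.mul_apply]
  -- the averaging operator
  let avg : V → V := fun x => ∑ t : T₀, ρ (t : G) x
  have havg_fix : ∀ x : V, ∀ s ∈ T₀, ρ s (avg x) = avg x := by
    intro x s hs
    simp only [avg, map_sum, hmul]
    exact Fintype.sum_equiv (Equiv.mulLeft (⟨s, hs⟩ : T₀)) _ _ (fun t => rfl)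
  have havg_mem : ∀ j, avg (b j) ∈ Submodule.span ℤ (Set.range b) := fun j =>
    Submodule.sum_mem _ fun t _ => hstab t t.2 j
  choose c hc using fun j => hline (avg (b j)) (havg_mem j) (havg_fix (b j))
  -- `avg (i u) = |T₀| • i u`
  have h1 : avg (Complex.I • u) = (Fintype.card T₀ : ℂ) • (Complex.I • u) := by
    have hfix : ∀ t : T₀, ρ (t : G) u = u := fun t => hu t t.2
    simp only [avg, map_smul, hfix, Finset.sum_const, Finset.card_univ]
    rw [Nat.cast_smul_eq_nsmul]
  -- `avg (i u) = (Σ r_j c_j) • u`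
  have h2 : avg (Complex.I • u) = (∑ j, (r j : ℂ) * c j) • u := by
    rw [← hr]
    simp only [avg, map_sum]
    rw [Finset.sum_comm, Finset.sum_smul]
    refine Finset.sum_congr rfl fun j _ => ?_
    have hj : ∀ t : T₀, ρ (t : G) (r j • b j) = (r j : ℂ) • ρ (t : G) (b j) := fun t => by
      rw [← Complex.coe_smul, map_smul]
    simp only [hj]
    rw [← Finset.smul_sum, mul_smul]
    exact congrArg ((r j : ℂ) • ·) (hc j)
  have h3 : ((Fintype.card T₀ : ℂ) * Complex.I - ∑ j, (r j : ℂ) * c j) • u = 0 := by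
    rw [sub_smul, mul_smul, ← h1, h2, sub_self]
  have h4 : (Fintype.card T₀ : ℂ) * Complex.I = ∑ j, (r j : ℂ) * c j := by
    rcases smul_eq_zero.mp h3 with h | h
    · exact sub_eq_zero.mp h
    · exact absurd h hu0
  by_contra hall
  push Not at hall
  have him : ∀ j, (c j).im = 0 := fun j => hall _ (havg_mem j) (c j) (hc j)
  have h5 := congrArg Complex.im h4
  simp only [Complex.mul_im, Complex.natCast_re, Complex.I_im, mul_one, Complex.natCast_im, Complex.I_re, mul_zero, add_zero,
    Complex.im_sum, Complex.ofReal_re, him, Complex.ofReal_im, zero_mul, Finset.sum_const_zero] at h5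
  exact absurd h5 (by exact_mod_cast Fintype.card_ne_zero)

end Averaging

/-! ## §4 Complex multiplication of a period lattice from two periods -/

/-- **A period lattice `Λ` containing `ℝ`-independent `p₁, p₂` with `c·p₁, c·p₂ ∈ Λ` and `Im c ≠ 0` has complex multiplication**:
with `p₁ = aω₁ + bω₂`, `p₂ = c'ω₁ + dω₂`, `δ = ad − bc' ≠ 0`, one has `δω₁, δω₂ ∈ ℤp₁ + ℤp₂`, so `(δc)Λ ⊆ c(ℤp₁ + ℤp₂) ⊆ Λ` and
`δc ∉ ℤ`. [folklore] -/
theorem hasCM_of_mul_mem (L : PeriodPair) {p₁ p₂ c : ℂ} (hp₁ : p₁ ∈ L.lattice) (hp₂ : p₂ ∈ L.lattice)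
    (hind : LinearIndependent ℝ ![p₁, p₂]) (h₁ : c * p₁ ∈ L.lattice) (h₂ : c * p₂ ∈ L.lattice) (hc : c.im ≠ 0) :
    L.HasCM := by
  obtain ⟨a, b, hp1⟩ := PeriodPair.mem_lattice.mp hp₁
  obtain ⟨c', d, hp2⟩ := PeriodPair.mem_lattice.mp hp₂
  have hpair := LinearIndependent.pair_iff.mp hind
  -- the determinant
  set δ : ℤ := a * d - b * c' with hδ_def
  have hδω₁ : (δ : ℂ) * L.ω₁ = d * p₁ - b * p₂ := by
    rw [← hp1, ← hp2, hδ_def]; push_cast; ring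
  have hδω₂ : (δ : ℂ) * L.ω₂ = -c' * p₁ + a * p₂ := by
    rw [← hp1, ← hp2, hδ_def]; push_cast; ring
  have hδ : δ ≠ 0 := by
    intro h0
    have e1 : (d : ℝ) • p₁ + (-(b : ℝ)) • p₂ = 0 := by
      rw [Complex.real_smul, Complex.real_smul]; push_cast
      have := hδω₁; rw [h0] at this; push_cast at this
      linear_combination -this
    have e2 : (-(c' : ℝ)) • p₁ + (a : ℝ) • p₂ = 0 := by
      rw [Complex.real_smul, Complex.real_smul]; push_cast
      have := hδω₂; rw [h0] at this; push_cast at this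
      linear_combination -this
    obtain ⟨hd, hb⟩ := hpair _ _ e1
    obtain ⟨-, ha⟩ := hpair _ _ e2
    have ha0 : (a : ℂ) = 0 := by exact_mod_cast (show (a : ℝ) = 0 from ha)
    have hb0 : (b : ℂ) = 0 := by exact_mod_cast (show (b : ℝ) = 0 from neg_eq_zero.mp hb)
    have hp0 : p₁ = 0 := by rw [← hp1, ha0, hb0]; ring
    have := (hpair 1 0 (by rw [hp0]; simp)).1
    exact one_ne_zero this
  refine ⟨(δ : ℂ) * c, ?_, ?_⟩
  · intro n hn
    have h := congrArg Complex.im hn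
    simp only [Complex.mul_im, Complex.intCast_re, Complex.intCast_im, zero_mul, add_zero] at h
    rcases mul_eq_zero.mp h with h' | h'
    · exact hδ (by exact_mod_cast h')
    · exact hc h'
  · intro l hl
    obtain ⟨m, k, rfl⟩ := PeriodPair.mem_lattice.mp hl
    have e : (δ : ℂ) * c * (m * L.ω₁ + k * L.ω₂) =
        ((m * d - k * c' : ℤ) : ℂ) * (c * p₁) + ((-(m * b) + k * a : ℤ) : ℂ) * (c * p₂) := by
      push_cast
      linear_combination (c * m) * hδω₁ + (c * k) * hδω₂
    rw [e]
    refine add_mem ?_ ?_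
    · rw [← zsmul_eq_mul]; exact L.lattice.smul_mem _ h₁
    · rw [← zsmul_eq_mul]; exact L.lattice.smul_mem _ h₂

end Summit.BirchSwinnertonDyer.BirchSwinnertonDyer.Theorems.CartanCover.CMRank

end
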